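import Summits.CriticalPhenomena.SAWScalingLimit.Theorems.SAWLoopFugacityFlowSimpleSubseqLimitsFarReturnPassage
import Summits.CriticalPhenomena.SAWScalingLimit.Theorems.SubseqIdentification.Negative.ReversalLattice
import Literature.Probability.RandomPlanarGeometry.ChordalReversibility
import HarnessLib

/-!
# Endpoint bookkeeping by time reversal — support file for `stub_endpoints`
(line `slit-continuous-restriction` of the crux `SAWLoopFugacityFlow.SimpleSubseqLimits`,
stmt-CriticalPhenomena-4982; registered skeleton
`Summits/CriticalPhenomena/SAWScalingLimit/Cruxes/SimpleSubseqLimits/Lines/slit_continuous_restriction.lean`)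

The stub `stub_endpoints : FarReturnNullOffTarget → FarReturnNull`: if, under every subsequential weak
limit `ν` of the critical SAW laws, every OFF-TARGET far return (an exact far first-hit return
`(v, T, t')` at `B̄(q, r)` whose past `γ [0, T]` stays `η`-away from the target `b = D.pt 1`) is
`ν`-null, then EVERY exact far return is `ν`-null.

Proof. `ν`-a.e. class runs from `a = D.pt 0` to `b = D.pt 1`, `a ≠ b`
(`Negative.ae_source_target_range_of_weakLimitAlong`). For a representative `γ` with a far return
`(v, T, t')` at `(q, r)` there are three cases.
* (A) the past `γ [0, T]` misses `b`: by compactness it is `η`-away from `b` for some `η = 1/(k+1)`, so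
  the same witnesses give an off-target far return at `(q, r, 1/(k+1))` (`offTarget_of_forall_ne`).
* (B) the past visits `b`, first at the time `f ≤ T`, and `γ` is back at `a` at some time `ℓ > f`: just
  before `f` the curve is at a point `γ m ≠ a` (`m < f`), and the loop `γ 0 = γ ℓ = a` through `γ m`
  is an off-target far return at a small ball with Gaussian-rational centre near `γ m` and rational
  radius, whose first hit happens before `m < f`, hence before the first visit of `b`
  (`exists_offTarget_of_loop`).
* (C) the past visits `b` first at `f ≤ T` and `γ` never returns to `a` after `f`: the far return forces
  a point `γ m ≠ b` with `m > f` (else `γ v = γ t' = b = γ T`, contradicting the guard), so the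
  REVERSED curve `γ̃ = γ ∘ σ` runs the loop `γ̃ 0 = b → γ m → b = γ̃ (σ f)` while its past `γ̃ [0, σ m]
  = γ [m, 1]` misses `a = D.swap.pt 1`: an off-target far return of `γ̃` in the swapped domain
  `D.swap = (D; b, a)` (`exists_offTarget_of_loop` again).
The events in (A)–(C) range over COUNTABLY many data (`η = 1/(k+1)`, Gaussian-rational centres, rational
radii), so they are `ν`-null by the hypothesis — in case (C) applied to the reversed limit: the exact
lattice reversibility of `SAW.law` (`SubseqIdentification.Negative.integral_curve_law_swap`,
`isEndpointApprox_swap`) makes `reverse_* ν` a subsequential limit for `(D.swap; b, a)`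
(`isSubseqLimit_swap`), and `CurveClass.ae_map_reverse_iff` pulls the nullity back.

Contents: verbatim copies of the line's vocabulary `OffTargetFarReturn`, `offTargetFarReturnEvent`,
`FarReturnNullOffTarget`, `FarReturnNull`; `isSubseqLimit_swap`; `offTarget_of_forall_ne`,
`exists_offTarget_of_loop`, `farReturn_trichotomy`; `ae_notMem_offTargetFarReturnEvent`; the stub
`stub_endpoints`. No named facts.
-/

noncomputable section

open MeasureTheory Filter Topology Set Metric Function
open Literature.Probability.RandomPlanarGeometry Literature.Probability.RandomPlanarGeometry.SAW
open Literature.Probability.LatticeModels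
open scoped ENNReal NNReal BoundedContinuousFunction unitInterval

namespace Summit.CriticalPhenomena.SAWScalingLimit.Theorems.SimpleSubseqLimits.SlitRestriction.Endpoints

open Summit.CriticalPhenomena.SAWScalingLimit.Theorems.SimpleSubseqLimits.Negative
  (ae_source_target_range_of_weakLimitAlong)
open Summit.CriticalPhenomena.SAWScalingLimit.Theorems.SimpleSubseqLimits.MarkedPointRevisit.Passage
  (IsSubseqLimit)
open Summit.CriticalPhenomena.SAWScalingLimit.Theorems.SimpleSubseqLimits.FirstHitFlat (exists_firstHit)
open Summit.CriticalPhenomena.SAWScalingLimit.Theorems.SimpleSubseqLimits.FirstHit.Passage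
  (gaussRat countable_gaussRat dense_gaussRat)
open Summit.CriticalPhenomena.SAWScalingLimit.Theorems.SimpleSubseqLimits.FarPast.Passage
  (FarReturn farReturnEvent exists_slack_Iic)
open Summit.CriticalPhenomena.SAWScalingLimit.Theorems.SubseqIdentification.Negative
  (integral_curve_law_swap isEndpointApprox_swap)

/-! ### Vocabulary (verbatim copies of the line skeleton) -/

/-- **Off-target far return** of a curve at the closed ball `B̄(q, r)` in the Dobrushin domain `D`: an
exact far first-hit return (`FarPast.Passage.FarReturn`: times `v < T ≤ t'`, `T` the first hitting time of
`B̄(q, r)`, `γ [0, v]` outside the guard ball `B̄(q, 5r)`, `γ t' = γ v`) whose past `γ [0, T]` stays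
`η`-away from the target `b = D.pt 1`. [folklore] -/
def OffTargetFarReturn (D : DobrushinDomain) (γ : Curve ℂ) (q : ℂ) (r η : ℝ) : Prop :=
  ∃ v T t' : I, v < T ∧ T ≤ t' ∧ γ T ∈ closedBall q r ∧ (∀ u : I, u < T → γ u ∉ closedBall q r) ∧
    (∀ u : I, u ≤ v → 5 * r < dist (γ u) q) ∧ γ t' = γ v ∧
      ∀ u : I, u ≤ T → η ≤ dist (γ u) (D.pt 1)

/-- The event "some representative has an off-target far return at `(q, r, η)`". [folklore] -/
def offTargetFarReturnEvent (D : DobrushinDomain) (q : ℂ) (r η : ℝ) : Set (CurveClass ℂ) :=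
  {c | ∃ γ : Curve ℂ, CurveClass.mk γ = c ∧ OffTargetFarReturn D γ q r η}

/-- **Off-target far returns are null** under every subsequential weak limit of the critical SAW laws (what
the transfer stub delivers from sequential slit avoidance and SHAPE). -/
def FarReturnNullOffTarget : Prop :=
  ∀ (D : DobrushinDomain) (a b : ℝ → Site 2) (s : ℕ → ℝ) (ν : Measure (CurveClass ℂ)),
    SAW.IsEndpointApprox D a b → IsSubseqLimit D a b s ν →
      ∀ (q : ℂ) (r η : ℝ), 0 < r → 0 < η → ν (offTargetFarReturnEvent D q r η) = 0

/-- **All far returns are null** under every subsequential weak limit (the ν-level ORDER statement the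
guarded Rohde–Schramm closing consumes; `FarPast.Passage.farReturnEvent`). -/
def FarReturnNull : Prop :=
  ∀ (D : DobrushinDomain) (a b : ℝ → Site 2) (s : ℕ → ℝ) (ν : Measure (CurveClass ℂ)),
    SAW.IsEndpointApprox D a b → IsSubseqLimit D a b s ν →
      ∀ (q : ℂ) (r : ℝ), 0 < r → ν (farReturnEvent q r) = 0

/-! ### Reversal of subsequential limits -/

/-- **A subsequential weak limit read backwards is a subsequential weak limit for the swapped domain.**
If the critical SAW laws of `(D; a_δ, b_δ)` converge along `s n → 0⁺` to `ν`, then those of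
`(D.swap; b_δ, a_δ)` converge along the same sequence to `reverse_* ν`: at every mesh the `b → a` law is
the push-forward of the `a → b` law along time reversal, which reverses the curve class
(`SubseqIdentification.Negative.integral_curve_law_swap`), and `f ∘ reverse` is a bounded continuous
test function. [folklore] -/
theorem isSubseqLimit_swap {D : DobrushinDomain} {a b : ℝ → Site 2} {s : ℕ → ℝ}
    {ν : Measure (CurveClass ℂ)} (hL : IsSubseqLimit D a b s ν) :
    IsSubseqLimit D.swap b a s (ν.map CurveClass.reverse) := by
  obtain ⟨hs, hν, hw⟩ := hL
  haveI := hν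
  refine ⟨hs, inferInstance, fun f => ?_⟩
  rw [integral_map CurveClass.measurable_reverse.aemeasurable f.continuous.aestronglyMeasurable]
  have h := hw (f.compContinuous ⟨CurveClass.reverse, CurveClass.continuous_reverse⟩)
  simp only [BoundedContinuousFunction.compContinuous_apply, ContinuousMap.coe_mk] at h
  exact h.congr fun n => (integral_curve_law_swap (f := fun c => f c)).symm

/-! ### Curve combinatorics -/

/-- **Case (A): a far return whose past misses the target is off-target.** If `(v, T, t')` witnesses a
far return of `γ` at `(q, r)` and `γ u ≠ b` for all `u ≤ T`, then by compactness of `[0, T]` the past is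
`1/(k+1)`-away from `b` for some `k`, and the same witnesses give an off-target far return. [folklore] -/
theorem offTarget_of_forall_ne (D : DobrushinDomain) {γ : Curve ℂ} {q : ℂ} {r : ℝ} {v T t' : I}
    (hvT : v < T) (hTt : T ≤ t') (hT : γ T ∈ closedBall q r)
    (hfirst : ∀ u : I, u < T → γ u ∉ closedBall q r)
    (hguard : ∀ u : I, u ≤ v → 5 * r < dist (γ u) q) (hret : γ t' = γ v)
    (hmiss : ∀ u : I, u ≤ T → γ u ≠ D.pt 1) :
    ∃ k : ℕ, OffTargetFarReturn D γ q r (1 / ((k : ℝ) + 1)) := by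
  obtain ⟨η, hη, hηle⟩ := exists_slack_Iic γ (D.pt 1) (c := 0) (w := T)
    (fun u hu => dist_pos.2 (hmiss u hu))
  obtain ⟨k, hk⟩ := exists_nat_one_div_lt hη
  exact ⟨k, v, T, t', hvT, hTt, hT, hfirst, hguard, hret, fun u hu => hk.le.trans (hηle u hu)⟩

/-- **The loop lemma (cases (B) and (C)).** If `γ` is back at its starting point at time `ℓ`
(`γ ℓ = γ 0`), passes at an earlier time `m < ℓ` through a point `γ m ≠ γ 0`, and misses the target
`b = D.pt 1` on `[0, m]`, then `γ` has an off-target far return with Gaussian-rational centre, positive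
rational radius and separation `1/(k+1)`: with `M = dist (γ m) (γ 0) > 0`, a centre `q'` within `M/16`
of `γ m` and a rational radius `r' ∈ (M/16, 3M/16)`, the witnesses are `v' = 0`, `T'` the first hit of
`B̄(q', r')` (`0 < T' ≤ m`, since `dist (γ 0) q' > 15M/16 > 5r'`), and `t'' = ℓ`; the past `γ [0, T']`
lies in `γ [0, m]`, a compact piece missing `b`. [folklore] -/
theorem exists_offTarget_of_loop (D : DobrushinDomain) (γ : Curve ℂ) {m ℓ : I} (hmℓ : m < ℓ)
    (hℓ : γ ℓ = γ 0) (hm : γ m ≠ γ 0) (hmiss : ∀ u : I, u ≤ m → γ u ≠ D.pt 1) :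
    ∃ q ∈ gaussRat, ∃ r : ℚ, 0 < r ∧ ∃ k : ℕ, OffTargetFarReturn D γ q r (1 / ((k : ℝ) + 1)) := by
  have hM : 0 < dist (γ m) (γ 0) := dist_pos.2 hm
  obtain ⟨q, hq, hqm⟩ := dense_gaussRat.exists_dist_lt (γ m)
    (by positivity : (0 : ℝ) < dist (γ m) (γ 0) / 16)
  obtain ⟨r, hr₁, hr₂⟩ := exists_rat_btwn
    (show dist (γ m) (γ 0) / 16 < 3 * dist (γ m) (γ 0) / 16 by linarith)
  have hr0 : (0 : ℝ) < r := lt_trans (by positivity) hr₁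
  have hmball : γ m ∈ closedBall q (r : ℝ) := by
    rw [mem_closedBall]
    linarith
  have h0q : 5 * (r : ℝ) < dist (γ 0) q := by
    have h := dist_triangle (γ m) q (γ 0)
    rw [dist_comm q (γ 0)] at h
    linarith
  obtain ⟨T, hTm, hT, hfirst⟩ := exists_firstHit γ isClosed_closedBall hmball
  have h0T : (0 : I) < T := by
    refine lt_of_le_of_ne unitInterval.nonneg' fun h0 => ?_
    rw [← h0, mem_closedBall] at hT
    linarith
  obtain ⟨η, hη, hηle⟩ := exists_slack_Iic γ (D.pt 1) (c := 0) (w := T)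
    (fun u hu => dist_pos.2 (hmiss u (hu.trans hTm)))
  obtain ⟨k, hk⟩ := exists_nat_one_div_lt hη
  refine ⟨q, hq, r, by exact_mod_cast hr0, k, 0, T, ℓ, h0T, hTm.trans hmℓ.le, hT, hfirst,
    fun u hu => ?_, hℓ, fun u hu => hk.le.trans (hηle u hu)⟩
  rw [le_antisymm hu unitInterval.nonneg']
  exact h0q

/-- **Trichotomy of far returns of a curve from `a = D.pt 0` to `b = D.pt 1`.** A far return at `(q, r)`,
`0 < r`, of a curve `γ` with `γ 0 = a`, `γ 1 = b` is (A) an off-target far return at `(q, r, 1/(k+1))`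
for some `k`, or (B) `γ` has an off-target far return at Gaussian-rational/rational data, or (C) the
REVERSED curve has one in the swapped domain `D.swap = (D; b, a)`. (A): the past `γ [0, T]` misses `b`.
Otherwise let `f ≤ T` be the first visit of `b` (`0 < f` as `a ≠ b`). (B): `γ ℓ = a` for some `ℓ > f`
— pick `m < f` near `f` with `γ m ≠ a` (continuity at `γ f = b ≠ a`) and apply the loop lemma. (C):
`γ ≠ a` on `(f, 1]` — the guard forces some `γ m ≠ b`, `m > f` (else `γ v = γ t' = b = γ T` is both
`5r`-far from and `r`-close to `q`), and the loop lemma applies to `γ ∘ σ` with times `σ m < σ f`,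
target `D.swap.pt 1 = a` missed on `[0, σ m] = σ [m, 1]`. [folklore] -/
theorem farReturn_trichotomy (D : DobrushinDomain) {γ : Curve ℂ} {q : ℂ} {r : ℝ} (hr : 0 < r)
    (h : FarReturn γ q r) (h0 : γ 0 = D.pt 0) (h1 : γ 1 = D.pt 1) :
    (∃ k : ℕ, OffTargetFarReturn D γ q r (1 / ((k : ℝ) + 1))) ∨
    (∃ q' ∈ gaussRat, ∃ r' : ℚ, 0 < r' ∧ ∃ k : ℕ,
      OffTargetFarReturn D γ q' r' (1 / ((k : ℝ) + 1))) ∨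
    (∃ q' ∈ gaussRat, ∃ r' : ℚ, 0 < r' ∧ ∃ k : ℕ,
      OffTargetFarReturn D.swap γ.reverse q' r' (1 / ((k : ℝ) + 1))) := by
  obtain ⟨v, T, t', hvT, hTt, hT, hfirst, hguard, hret⟩ := h
  have hab : D.pt 0 ≠ D.pt 1 := fun h => absurd (D.pt_injective h) (by decide)
  by_cases hA : ∀ u : I, u ≤ T → γ u ≠ D.pt 1
  · exact Or.inl (offTarget_of_forall_ne D hvT hTt hT hfirst hguard hret hA)
  push Not at hA
  obtain ⟨ub, hubT, hub⟩ := hA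
  -- the first visit `f` of the target
  obtain ⟨f, hfub, hf, hffirst⟩ :=
    exists_firstHit γ (isClosed_singleton (x := D.pt 1)) (show γ ub ∈ ({D.pt 1} : Set ℂ) from hub)
  have hf' : γ f = D.pt 1 := hf
  have h0f : 0 < f := lt_of_le_of_ne unitInterval.nonneg' fun h => hab (by rw [← h0, h, hf'])
  have hfT : f ≤ T := hfub.trans hubT
  by_cases hB : ∃ ℓ : I, f < ℓ ∧ γ ℓ = D.pt 0
  · -- case (B): a loop `a → γ m → a` before the first visit of `b`
    obtain ⟨ℓ, hfℓ, hℓ⟩ := hB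
    refine Or.inr (Or.inl ?_)
    have hopen : {u : I | γ u ≠ D.pt 0} ∈ 𝓝 f :=
      (isOpen_ne.preimage γ.continuous).mem_nhds (show γ f ≠ D.pt 0 by rw [hf']; exact hab.symm)
    obtain ⟨l, hlf, hl⟩ := exists_Ioc_subset_of_mem_nhds hopen ⟨0, h0f⟩
    obtain ⟨m, hlm, hmf⟩ := exists_between hlf
    have hm : γ m ≠ D.pt 0 := hl ⟨hlm, hmf.le⟩
    refine exists_offTarget_of_loop D γ (hmf.trans hfℓ) (by rw [hℓ, h0]) (by rwa [h0]) fun u hu => ?_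
    exact hffirst u (hu.trans_lt hmf)
  · -- case (C): reverse
    push Not at hB
    refine Or.inr (Or.inr ?_)
    have hm : ∃ m : I, f < m ∧ γ m ≠ D.pt 1 := by
      by_contra hcon
      push Not at hcon
      have hTb : γ T = D.pt 1 := by
        rcases hfT.lt_or_eq with hlt | heq
        · exact hcon T hlt
        · rw [← heq]; exact hf'
      have htb : γ t' = D.pt 1 := by
        rcases (hfT.trans hTt).lt_or_eq with hlt | heq
        · exact hcon t' hlt
        · rw [← heq]; exact hf'
      have hfar := hguard v le_rfl
      rw [← hret, htb, ← hTb] at hfar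
      rw [mem_closedBall] at hT
      linarith
    obtain ⟨m, hfm, hmb⟩ := hm
    refine exists_offTarget_of_loop D.swap γ.reverse (m := σ m) (ℓ := σ f)
      (unitInterval.symm_lt_symm.2 hfm) ?_ ?_ fun u hu => ?_
    · simp only [Curve.reverse_apply, unitInterval.symm_symm, unitInterval.symm_zero, hf', h1]
    · simpa only [Curve.reverse_apply, unitInterval.symm_symm, unitInterval.symm_zero, h1] using hmb
    · rw [MarkedDomain.pt_swap_one, Curve.reverse_apply]
      refine hB (σ u) (hfm.trans_le ?_)
      rw [← unitInterval.symm_symm m]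
      exact unitInterval.symm_le_symm.2 hu

/-! ### Nullity of the countable net of off-target events -/

/-- Under off-target nullity, `ν`-a.e. class lies outside ALL off-target far-return events with
Gaussian-rational centre, positive rational radius and separation `1/(k+1)` (a countable family).
[folklore] -/
theorem ae_notMem_offTargetFarReturnEvent (hOff : FarReturnNullOffTarget) {D : DobrushinDomain}
    {a b : ℝ → Site 2} {s : ℕ → ℝ} {ν : Measure (CurveClass ℂ)} (hab : SAW.IsEndpointApprox D a b)
    (hL : IsSubseqLimit D a b s ν) :
    ∀ᵐ c ∂ν, ∀ q : gaussRat, ∀ r : {x : ℚ // 0 < x}, ∀ k : ℕ,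
      c ∉ offTargetFarReturnEvent D (q : ℂ) ((r : ℚ) : ℝ) (1 / ((k : ℝ) + 1)) := by
  haveI : Countable gaussRat := countable_gaussRat.to_subtype
  rw [ae_all_iff]; intro q
  rw [ae_all_iff]; intro r
  rw [ae_all_iff]; intro k
  have hr : (0 : ℝ) < ((r : ℚ) : ℝ) := by exact_mod_cast r.2
  exact measure_eq_zero_iff_ae_notMem.1 (hOff D a b s ν hab hL q _ _ hr (by positivity))

/-! ### The stub -/

/-- **stub 3 — ENDPOINT BOOKKEEPING BY TIME REVERSAL**: off-target far-return nullity for all data (under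
every subsequential limit of every endpoint approximation of every Dobrushin domain) gives nullity of all
far returns. `ν`-a.e. class runs from `a` to `b`; by `farReturn_trichotomy` a far return at `(q, r)` puts
the class in one of countably many off-target events of `D` — null by hypothesis — or its reversal in one
of countably many off-target events of `D.swap` — null under `reverse_* ν`, a subsequential limit for
`(D.swap; b, a)` by exact lattice reversibility (`isSubseqLimit_swap`, `isEndpointApprox_swap`), pulled
back by `CurveClass.ae_map_reverse_iff`. [folklore] -/
theorem stub_endpoints : FarReturnNullOffTarget → FarReturnNull := by
  intro hOff D a b s ν hab hL q r hr
  haveI := hL.2.1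
  have hfree := ae_source_target_range_of_weakLimitAlong (ν := ν) hab hL.1 hL.2.2
  have hA : ∀ᵐ c ∂ν, ∀ k : ℕ, c ∉ offTargetFarReturnEvent D q r (1 / ((k : ℝ) + 1)) := by
    rw [ae_all_iff]; intro k
    exact measure_eq_zero_iff_ae_notMem.1 (hOff D a b s ν hab hL q r _ hr (by positivity))
  have hB := ae_notMem_offTargetFarReturnEvent hOff hab hL
  have hC := CurveClass.ae_map_reverse_iff.1
    (ae_notMem_offTargetFarReturnEvent hOff (isEndpointApprox_swap hab) (isSubseqLimit_swap hL))
  rw [measure_eq_zero_iff_ae_notMem]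
  filter_upwards [hfree, hA, hB, hC] with c hc hAc hBc hCc
  rintro ⟨γ, rfl, hfar⟩
  rcases farReturn_trichotomy D hr hfar hc.1 hc.2.1 with ⟨k, hk⟩ | ⟨q', hq', r', hr', k, hk⟩ |
    ⟨q', hq', r', hr', k, hk⟩
  · exact hAc k ⟨γ, rfl, hk⟩
  · exact hBc ⟨q', hq'⟩ ⟨r', hr'⟩ k ⟨γ, rfl, hk⟩
  · exact hCc ⟨q', hq'⟩ ⟨r', hr'⟩ k ⟨γ.reverse, rfl, hk⟩

end Summit.CriticalPhenomena.SAWScalingLimit.Theorems.SimpleSubseqLimits.SlitRestriction.Endpoints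

end
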